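import Mathlib
import HarnessLib
import Literature.AlgebraicGeometry.Resolution.AffineBlowup
import Summits.ResolutionOfSingularities.ResolutionOfSingularities.Theorems.WildQuotientsWildQuotientResolutionJordanFourTwistedChartDefs

/-!
# V4U piece T: the W TERM OF RECORD `chartW = D₊(T′t · H′³t²) = D₊(T′t) ⊓ D₊(H′³t²)` of `Bl_{I₆} 𝔸ⁿ`
(crux stmt-ResolutionOfSingularities-15640 `WildQuotients.WildQuotientResolution`, line `Sketch`;
chain w45c programme V4U, `L/w45c/V4U-DESIGN.md` §3 (the twisted root chart `W_T`), CHAIN v7.3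
§4 + res-L1-w45c-plan-1 RULING W-TERM 2026-08-27T05:55:03Z (SIG of record
`L/res-L1-w45c-plan-1/sig/ChartWSig.lean`, = res-L1-w45c-stub-2's definition of record 04:59:20Z);
filed by res-D-pv-033 AS res-L1-w45c-stub-5; [OURS · L1 W4.5c] — NOT a statement of any manuscript.)

`I₆` = the generator vector of record `![x_a², x_a x_b², x_a x_b x_c, x_a x_c³, x_b³, x_b² x_c², x_b x_c⁴, x_c⁶]`,
`T′ = JordanFour.tPrime`, `H′ = JordanFour.hPrime` (p499121). This file is the `W` binder of
`JordanFour.jordanFour_hasResolution_of_bricks` (p501160):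

* `JordanFour.tPrime_mem_I6` (`T′ = (3x_d − x_b)·g₀ − 3·g₂ + g₄`), `JordanFour.hPrime_cube_mem_I6_sq`
  (`H′³ ∈ I₆²`, eight cofactors on `gᵢgⱼ`; plan-1 `mem2_Hcube`, kernel-checked V6.1);
* `JordanFour.hCubeT2` — the degree-2 Rees element `H′³ t²`; `JordanFour.chartW` — the open
  `D₊(T′t · H′³t²)` of `Proj R[I₆t]`; `chartW_section_mem` (degree 3);
* `JordanFour.isAffineOpen_chartW` (**brick `HWaff`**: `Proj.isAffineOpen_basicOpen`) and
  `JordanFour.chartW_eq_inf` (`chartW = D₊(T′t) ⊓ D₊(H′³t²)`, `Proj.basicOpen_mul`).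
-/

-- single-problem summit: the doubled namespace component `ResolutionOfSingularities` is forced
set_option linter.dupNamespace false

noncomputable section

open MvPolynomial Polynomial AlgebraicGeometry Literature.AlgebraicGeometry.Resolution

namespace Summit.ResolutionOfSingularities.ResolutionOfSingularities.Theorems.WildQuotientResolution.JordanFour

variable (k : Type) [Field k] (n : ℕ) (a b c d : Fin n)

/-- **`T′ ∈ I₆`**: `T′ = (3 x_d − x_b)·x_a² − 3·(x_a x_b x_c) + x_b³`. [OURS · L1 W4.5c] -/
theorem tPrime_mem_I6 :
    tPrime k n a b c d ∈ Ideal.span (Set.range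
      (![X a ^ 2, X a * X b ^ 2, X a * X b * X c, X a * X c ^ 3, X b ^ 3, X b ^ 2 * X c ^ 2,
        X b * X c ^ 4, X c ^ 6] : Fin 8 → MvPolynomial (Fin n) k)) := by
  have h0 : (X a ^ 2 : MvPolynomial (Fin n) k) ∈ Ideal.span (Set.range
      (![X a ^ 2, X a * X b ^ 2, X a * X b * X c, X a * X c ^ 3, X b ^ 3, X b ^ 2 * X c ^ 2,
        X b * X c ^ 4, X c ^ 6] : Fin 8 → MvPolynomial (Fin n) k)) := Ideal.subset_span ⟨0, rfl⟩
  have h2 : (X a * X b * X c : MvPolynomial (Fin n) k) ∈ Ideal.span (Set.range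
      (![X a ^ 2, X a * X b ^ 2, X a * X b * X c, X a * X c ^ 3, X b ^ 3, X b ^ 2 * X c ^ 2,
        X b * X c ^ 4, X c ^ 6] : Fin 8 → MvPolynomial (Fin n) k)) := Ideal.subset_span ⟨2, rfl⟩
  have h4 : (X b ^ 3 : MvPolynomial (Fin n) k) ∈ Ideal.span (Set.range
      (![X a ^ 2, X a * X b ^ 2, X a * X b * X c, X a * X c ^ 3, X b ^ 3, X b ^ 2 * X c ^ 2,
        X b * X c ^ 4, X c ^ 6] : Fin 8 → MvPolynomial (Fin n) k)) := Ideal.subset_span ⟨4, rfl⟩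
  have e : tPrime k n a b c d =
      (3 * X d - X b) * (X a ^ 2) + (-3) * (X a * X b * X c) + X b ^ 3 := by
    simp only [tPrime]; ring
  rw [e]
  exact Ideal.add_mem _ (Ideal.add_mem _ (Ideal.mul_mem_left _ _ h0) (Ideal.mul_mem_left _ _ h2)) h4

/-- **`H′³ ∈ I₆²`** (eight explicit cofactors on the products `gᵢ gⱼ`; plan-1 V6.1 `mem2_Hcube`).
[OURS · L1 W4.5c] -/
theorem hPrime_cube_mem_I6_sq :
    hPrime k n a b c ^ 3 ∈ Ideal.span (Set.range
      (![X a ^ 2, X a * X b ^ 2, X a * X b * X c, X a * X c ^ 3, X b ^ 3, X b ^ 2 * X c ^ 2,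
        X b * X c ^ 4, X c ^ 6] : Fin 8 → MvPolynomial (Fin n) k)) ^ 2 := by
  have hg : ∀ j : Fin 8, ((![X a ^ 2, X a * X b ^ 2, X a * X b * X c, X a * X c ^ 3, X b ^ 3,
      X b ^ 2 * X c ^ 2, X b * X c ^ 4, X c ^ 6] : Fin 8 → MvPolynomial (Fin n) k) j) ∈
      Ideal.span (Set.range (![X a ^ 2, X a * X b ^ 2, X a * X b * X c, X a * X c ^ 3, X b ^ 3,
        X b ^ 2 * X c ^ 2, X b * X c ^ 4, X c ^ 6] : Fin 8 → MvPolynomial (Fin n) k)) :=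
    fun j => Ideal.subset_span ⟨j, rfl⟩
  have hmul : ∀ i j : Fin 8, (![X a ^ 2, X a * X b ^ 2, X a * X b * X c, X a * X c ^ 3, X b ^ 3,
      X b ^ 2 * X c ^ 2, X b * X c ^ 4, X c ^ 6] : Fin 8 → MvPolynomial (Fin n) k) i *
      (![X a ^ 2, X a * X b ^ 2, X a * X b * X c, X a * X c ^ 3, X b ^ 3,
      X b ^ 2 * X c ^ 2, X b * X c ^ 4, X c ^ 6] : Fin 8 → MvPolynomial (Fin n) k) j ∈
      Ideal.span (Set.range (![X a ^ 2, X a * X b ^ 2, X a * X b * X c, X a * X c ^ 3, X b ^ 3,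
        X b ^ 2 * X c ^ 2, X b * X c ^ 4, X c ^ 6] : Fin 8 → MvPolynomial (Fin n) k)) ^ 2 :=
    fun i j => by rw [pow_two]; exact Ideal.mul_mem_mul (hg i) (hg j)
  have e : hPrime k n a b c ^ 3 =
      (-(X b) - 6 * X c) * ((X a ^ 2) * (X a * X b ^ 2))
      + (-12 * X c) * ((X a ^ 2) * (X a * X b * X c))
      + (-8) * ((X a ^ 2) * (X a * X c ^ 3))
      + (3 * X b + 12 * X c) * ((X a ^ 2) * (X b ^ 3))
      + (12) * ((X a ^ 2) * (X b ^ 2 * X c ^ 2))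
      + (-3) * ((X a * X b ^ 2) * (X b ^ 3))
      + (-6) * ((X a * X b * X c) * (X b ^ 3))
      + (1) * ((X b ^ 3) * (X b ^ 3)) := by
    simp only [hPrime]; ring
  rw [e]
  refine Ideal.add_mem _ (Ideal.add_mem _ (Ideal.add_mem _ (Ideal.add_mem _ (Ideal.add_mem _
    (Ideal.add_mem _ (Ideal.add_mem _ (Ideal.mul_mem_left _ _ (hmul 0 1))
    (Ideal.mul_mem_left _ _ (hmul 0 2))) (Ideal.mul_mem_left _ _ (hmul 0 3)))
    (Ideal.mul_mem_left _ _ (hmul 0 4))) (Ideal.mul_mem_left _ _ (hmul 0 5)))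
    (Ideal.mul_mem_left _ _ (hmul 1 4))) (Ideal.mul_mem_left _ _ (hmul 2 4))) ?_
  exact Ideal.mul_mem_left _ _ (hmul 4 4)

/-- **The degree-2 Rees element `H′³ t² ∈ R[I₆ t]`.** [OURS · L1 W4.5c] -/
def hCubeT2 : reesAlgebra (Ideal.span (Set.range
      (![X a ^ 2, X a * X b ^ 2, X a * X b * X c, X a * X c ^ 3, X b ^ 3, X b ^ 2 * X c ^ 2,
        X b * X c ^ 4, X c ^ 6] : Fin 8 → MvPolynomial (Fin n) k))) :=
  ⟨monomial 2 (hPrime k n a b c ^ 3), reesAlgebra.monomial_mem.mpr (hPrime_cube_mem_I6_sq k n a b c)⟩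

/-- The underlying polynomial of `H′³ t²`. [folklore] -/
theorem coe_hCubeT2 :
    (hCubeT2 k n a b c : (MvPolynomial (Fin n) k)[X]) = monomial 2 (hPrime k n a b c ^ 3) :=
  rfl

/-- `H′³ t²` is homogeneous of degree `2`. [folklore] -/
theorem hCubeT2_mem : hCubeT2 k n a b c ∈ reesGrading (Ideal.span (Set.range
      (![X a ^ 2, X a * X b ^ 2, X a * X b * X c, X a * X c ^ 3, X b ^ 3, X b ^ 2 * X c ^ 2,
        X b * X c ^ 4, X c ^ 6] : Fin 8 → MvPolynomial (Fin n) k))) 2 :=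
  ⟨hPrime k n a b c ^ 3, rfl⟩

/-- **The W TERM OF RECORD**: `chartW = D₊(T′t · H′³t²) ⊆ Bl_{I₆} 𝔸ⁿ = Proj R[I₆t]` (the twisted
root chart `W_T = D₊(T′t) ∩ D(θ)`, `θ = H′³/T′²`, of V4U-DESIGN §3). [OURS · L1 W4.5c] -/
def chartW : (affineBlowup (Ideal.span (Set.range
      (![X a ^ 2, X a * X b ^ 2, X a * X b * X c, X a * X c ^ 3, X b ^ 3, X b ^ 2 * X c ^ 2,
        X b * X c ^ 4, X c ^ 6] : Fin 8 → MvPolynomial (Fin n) k)))).Opens :=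
  Proj.basicOpen (reesGrading _)
    (reesT (tPrime k n a b c d) (tPrime_mem_I6 k n a b c d) * hCubeT2 k n a b c)

/-- Unfolding `chartW`. [folklore] -/
theorem chartW_def : chartW k n a b c d = Proj.basicOpen (reesGrading _)
    (reesT (tPrime k n a b c d) (tPrime_mem_I6 k n a b c d) * hCubeT2 k n a b c) :=
  rfl

/-- The section `T′t · H′³t²` is homogeneous of degree `3`. [folklore] -/
theorem chartW_section_mem :
    reesT (tPrime k n a b c d) (tPrime_mem_I6 k n a b c d) * hCubeT2 k n a b c ∈
      reesGrading (Ideal.span (Set.range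
        (![X a ^ 2, X a * X b ^ 2, X a * X b * X c, X a * X c ^ 3, X b ^ 3, X b ^ 2 * X c ^ 2,
          X b * X c ^ 4, X c ^ 6] : Fin 8 → MvPolynomial (Fin n) k))) (1 + 2) :=
  SetLike.mul_mem_graded (reesT_mem _ _) (hCubeT2_mem k n a b c)

/-- The underlying polynomial of the section: `(T′ H′³) t³`. [folklore] -/
theorem coe_chartW_section :
    ((reesT (tPrime k n a b c d) (tPrime_mem_I6 k n a b c d) * hCubeT2 k n a b c :
      reesAlgebra (Ideal.span (Set.range
        (![X a ^ 2, X a * X b ^ 2, X a * X b * X c, X a * X c ^ 3, X b ^ 3, X b ^ 2 * X c ^ 2,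
          X b * X c ^ 4, X c ^ 6] : Fin 8 → MvPolynomial (Fin n) k)))) : (MvPolynomial (Fin n) k)[X]) =
      monomial 3 (tPrime k n a b c d * hPrime k n a b c ^ 3) := by
  change (monomial 1 (tPrime k n a b c d)) * (monomial 2 (hPrime k n a b c ^ 3)) = _
  rw [monomial_mul_monomial]

/-- **Brick `HWaff`: `chartW` is an affine open** (a basic open of `Proj` at a section of positive
degree; Mathlib `Proj.isAffineOpen_basicOpen`). [OURS · L1 W4.5c] -/
theorem isAffineOpen_chartW : IsAffineOpen (chartW k n a b c d) :=
  Proj.isAffineOpen_basicOpen _ _ (chartW_section_mem k n a b c d) (by norm_num)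

/-- **`chartW = D₊(T′t) ⊓ D₊(H′³t²)`.** [OURS · L1 W4.5c] -/
theorem chartW_eq_inf : chartW k n a b c d =
    Proj.basicOpen (reesGrading _) (reesT (tPrime k n a b c d) (tPrime_mem_I6 k n a b c d)) ⊓
      Proj.basicOpen (reesGrading _) (hCubeT2 k n a b c) :=
  Proj.basicOpen_mul _ _ _

end Summit.ResolutionOfSingularities.ResolutionOfSingularities.Theorems.WildQuotientResolution.JordanFour

end
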